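import Summits.ResolutionOfSingularities.ResolutionOfSingularities.Theorems.MaxContactCutPortCut
import Summits.ResolutionOfSingularities.ResolutionOfSingularities.Theorems.ExitCutTransport2
import Summits.ResolutionOfSingularities.ResolutionOfSingularities.Theorems.SpreadCutLaw3
import Literature.AlgebraicGeometry.Resolution.BlowupStalkCharts
import Literature.AlgebraicGeometry.Resolution.BlowupChartRsop
import Literature.AlgebraicGeometry.Resolution.RsopMonomialIdeals
import Literature.AlgebraicGeometry.Resolution.AlterationsEnlargingZ
import Literature.AlgebraicGeometry.Resolution.BlowupChartQuasiRegular
import Literature.AlgebraicGeometry.Resolution.PointBlowupOrder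
import Literature.AlgebraicGeometry.Resolution.RsopLocalization
import Literature.AlgebraicGeometry.Resolution.NodalBlowupChartAlgebra
import Literature.AlgebraicGeometry.Resolution.QuasiRegularSequences
import Literature.AlgebraicGeometry.Resolution.TauOne
import Literature.AlgebraicGeometry.Resolution.HironakaTauScheme
import Literature.AlgebraicGeometry.Resolution.HironakaDirectrixLemmas
import Literature.AlgebraicGeometry.Resolution.StalkSpecializesLocalization
import Literature.AlgebraicGeometry.Resolution.StrictNormalCrossingsFlatDescent
import Literature.AlgebraicGeometry.Resolution.CurveCentreNearPointGammaPrime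
import Literature.AlgebraicGeometry.Resolution.StalkIdealLemmas
import Literature.AlgebraicGeometry.Resolution.MarkedIdealsArithmetic
import Literature.AlgebraicGeometry.Resolution.MarkedIdealsLemmas
import Literature.AlgebraicGeometry.Resolution.HypersurfaceTransform
import Literature.AlgebraicGeometry.Resolution.RegularBlowup
import Literature.AlgebraicGeometry.Resolution.PrimeDivisorIdeals
import Literature.AlgebraicGeometry.Resolution.PointBlowupHsFunMono
import Literature.AlgebraicGeometry.Resolution.BlowupDisjointCentreWeights
import HarnessLib

/-!
# TowerCut (T1/8) — weighted monomial ideals `qWeighted`: membership, degree bounds, ring maps, the chart law, the colon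

see `Theorems/MaxContactCutTowerCut.lean` (slice T8) for the main theorem `spreadExit_holds : SpreadExit`, the mechanism and the
sources ([Hironaka1964], [CossartJannsenSaito2020], [CutkoskyBook2004] §7).  `decomp-res-lens-2` g29, node «TowerCut».
-/

open CategoryTheory AlgebraicGeometry IsLocalRing TopologicalSpace Topology
open Literature.AlgebraicGeometry.Resolution
open Summit.ResolutionOfSingularities.ResolutionOfSingularities.Theorems
open Summit.ResolutionOfSingularities.ResolutionOfSingularities.Theorems.WeakOrderReduction
open Summit.ResolutionOfSingularities.ResolutionOfSingularities.Theorems.DeltaFaceCutClasses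
open Summit.ResolutionOfSingularities.ResolutionOfSingularities.Theorems.RelativeDeltaCut
open Summit.ResolutionOfSingularities.ResolutionOfSingularities.Theorems.SpreadCut

namespace Summit.ResolutionOfSingularities.ResolutionOfSingularities.Theorems.TowerCut

/-! ## §Q  Weighted monomial ideals `qWeighted` (the landed `DeltaFaceCutClasses.qWeighted`, VERBATIM): membership,
degree bounds, behaviour under ring maps, the CHART LAW and the colon by the exceptional parameter -/

section Weighted

variable {R : Type} [CommRing R]

/-- The total degree of an exponent vector is `m₀ + |α|`. [folklore] -/
theorem degree_eq_add_uDeg {d : ℕ} (m : Fin (d + 1) →₀ ℕ) :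
    (Finset.univ.sum fun j => m j) = m 0 + uDeg m := by
  rw [Fin.sum_univ_succ]; rfl

/-- `cMon c m = ∏ⱼ c_j ^ m_j`. [folklore] -/
theorem cMon_eq_prod {d : ℕ} (c : Fin (d + 1) → R) (m : Fin (d + 1) →₀ ℕ) :
    cMon c m = Finset.univ.prod fun j => c j ^ m j := by
  unfold cMon
  exact Finsupp.prod_pow m c

/-- Two variables: `cMon ![z, u] m = z ^ m 0 * u ^ m 1`. [folklore] -/
theorem cMon_two (z u : R) (m : Fin 2 →₀ ℕ) : cMon ![z, u] m = z ^ m 0 * u ^ m 1 := by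
  rw [cMon_eq_prod, Fin.prod_univ_two]; rfl

/-- Two variables: `wdeg a b m = a m₀ + b m₁`. [folklore] -/
theorem wdeg_two (a b : ℕ) (m : Fin 2 →₀ ℕ) : wdeg a b m = a * m 0 + b * m 1 := by
  unfold wdeg uDeg
  rw [Fin.sum_univ_one]; rfl

/-- Membership of a two-variable monomial in `Q(l)`. [folklore] -/
theorem pow_mul_pow_mem_qWeighted (z u : R) {a b l i j : ℕ} (h : l ≤ a * i + b * j) :
    z ^ i * u ^ j ∈ qWeighted ![z, u] a b l := by
  refine Ideal.subset_span ⟨Finsupp.equivFunOnFinite.symm ![i, j], ?_, ?_⟩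
  · rw [wdeg_two]; simpa using h
  · rw [cMon_two]; simp

/-- `Q(l)` is contained in `K` as soon as every monomial of weight `≥ l` is. [folklore] -/
theorem qWeighted_two_le {z u : R} {a b l : ℕ} {K : Ideal R}
    (h : ∀ i j : ℕ, l ≤ a * i + b * j → z ^ i * u ^ j ∈ K) : qWeighted ![z, u] a b l ≤ K := by
  unfold qWeighted
  rw [Ideal.span_le]
  rintro _ ⟨m, hm, rfl⟩
  rw [wdeg_two] at hm
  rw [SetLike.mem_coe, cMon_two]
  exact h _ _ hm

/-- Ring maps carry `Q` to `Q` of the image frame. [folklore] -/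
theorem map_qWeighted {S : Type} [CommRing S] (θ : R →+* S) {d : ℕ} (c : Fin (d + 1) → R) (a b l : ℕ) :
    (qWeighted c a b l).map θ = qWeighted (fun j => θ (c j)) a b l := by
  unfold qWeighted
  rw [Ideal.map_span]
  congr 1
  ext x
  constructor
  · rintro ⟨_, ⟨m, hm, rfl⟩, rfl⟩
    refine ⟨m, hm, ?_⟩
    rw [cMon_eq_prod, cMon_eq_prod, map_prod]
    simp only [map_pow]
  · rintro ⟨m, hm, rfl⟩
    refine ⟨cMon c m, ⟨m, hm, rfl⟩, ?_⟩
    rw [cMon_eq_prod, cMon_eq_prod, map_prod]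
    simp only [map_pow]

omit [CommRing R] in
/-- The image frame of `![z, u]`. [folklore] -/
theorem comp_vec_two {S : Type} (θ : R → S) (z u : R) : (fun j => θ (![z, u] j)) = ![θ z, θ u] := by
  funext j; fin_cases j <;> rfl

omit [CommRing R] in
/-- The image frame of `![z, u, φ]`. [folklore] -/
theorem comp_vec_three {S : Type} (θ : R → S) (z u φ : R) :
    (fun j => θ (![z, u, φ] j)) = ![θ z, θ u, θ φ] := by
  funext j; fin_cases j <;> rfl

/-- **Degree bound**: for `b ≤ a`, `0 < a` and `N a ≤ l`, every monomial of weight `≥ l` has total degree `≥ N`.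
[folklore] -/
theorem le_degree_of_le_wdeg {d : ℕ} {a b l N : ℕ} (hba : b ≤ a) (ha : 0 < a) (hN : N * a ≤ l)
    (m : Fin (d + 1) →₀ ℕ) (hm : l ≤ wdeg a b m) : N ≤ m 0 + uDeg m := by
  unfold wdeg at hm
  have h1 : b * uDeg m ≤ a * uDeg m := Nat.mul_le_mul_right _ hba
  have h2 : N * a ≤ a * (m 0 + uDeg m) := by nlinarith
  rw [Nat.mul_comm N a] at h2
  exact Nat.le_of_mul_le_mul_left h2 ha

/-- A monomial lies in the power of the frame ideal given by its degree. [folklore] -/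
theorem cMon_mem_pow {d : ℕ} (c : Fin (d + 1) → R) (m : Fin (d + 1) →₀ ℕ) :
    cMon c m ∈ Ideal.span (Set.range c) ^ (Finset.univ.sum fun j => m j) := by
  rw [cMon_eq_prod, ← Finset.prod_pow_eq_pow_sum]
  exact Ideal.prod_mem_prod fun j _ => Ideal.pow_mem_pow (Ideal.subset_span (Set.mem_range_self j)) _

/-- **`Q(l) ⊆ (c)^N`** for `b ≤ a`, `0 < a`, `N a ≤ l`. [folklore] -/
theorem qWeighted_le_pow {d : ℕ} (c : Fin (d + 1) → R) {a b l N : ℕ} (hba : b ≤ a) (ha : 0 < a)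
    (hN : N * a ≤ l) : qWeighted c a b l ≤ Ideal.span (Set.range c) ^ N := by
  unfold qWeighted
  rw [Ideal.span_le]
  rintro _ ⟨m, hm, rfl⟩
  have hdeg := le_degree_of_le_wdeg hba ha hN m hm
  rw [← degree_eq_add_uDeg] at hdeg
  exact Ideal.pow_le_pow_right hdeg (cMon_mem_pow c m)

/-- **`Q(l) ⊆ (c)^(N+1)`** for `b ≤ a` and `N a < l`. [folklore] -/
theorem qWeighted_le_pow_of_lt {d : ℕ} (c : Fin (d + 1) → R) {a b l N : ℕ} (hba : b ≤ a) (hN : N * a < l) :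
    qWeighted c a b l ≤ Ideal.span (Set.range c) ^ (N + 1) := by
  unfold qWeighted
  rw [Ideal.span_le]
  rintro _ ⟨m, hm, rfl⟩
  have hdeg : N + 1 ≤ m 0 + uDeg m := by
    unfold wdeg at hm
    have h1 : b * uDeg m ≤ a * uDeg m := Nat.mul_le_mul_right _ hba
    have h2 : N * a < a * (m 0 + uDeg m) := by nlinarith
    rw [Nat.mul_comm N a] at h2
    exact Nat.succ_le_of_lt (Nat.lt_of_mul_lt_mul_left h2)
  rw [← degree_eq_add_uDeg] at hdeg
  exact Ideal.pow_le_pow_right hdeg (cMon_mem_pow c m)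

/-- **Completing a part of a regular system of parameters** (the definition, with the embedding dimension read off
`dim R`). [folklore] -/
theorem exists_append_of_isRsopPart {A : Type} [CommRing A] [IsLocalRing A] {k : ℕ} {z : Fin k → A}
    (hz : IsRsopPart z) : ∃ (e : ℕ) (y : Fin e → A), (maximalIdeal A).spanFinrank = k + e ∧
      Ideal.span (Set.range (Fin.append z y)) = maximalIdeal A := by
  obtain ⟨hreg, e, y, hdim, hspan⟩ := hz
  refine ⟨e, y, ?_, by rw [range_fin_append]; exact hspan⟩
  have h := IsRegularLocalRing.spanFinrank_maximalIdeal (R := A)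
  rw [hdim] at h
  exact_mod_cast h

/-- **`Q(l) ⊆ (c)`** for `1 ≤ l`. [folklore] -/
theorem qWeighted_le_span {d : ℕ} (c : Fin (d + 1) → R) {a b l : ℕ} (hl : 1 ≤ l) :
    qWeighted c a b l ≤ Ideal.span (Set.range c) := by
  unfold qWeighted
  rw [Ideal.span_le]
  rintro _ ⟨m, hm, rfl⟩
  have hne : m ≠ 0 := by
    rintro rfl
    simp [wdeg, uDeg] at hm
    omega
  obtain ⟨j, hj⟩ : ∃ j, m j ≠ 0 := by
    by_contra h
    push Not at h
    exact hne (Finsupp.ext h)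
  rw [SetLike.mem_coe, cMon_eq_prod, ← Finset.mul_prod_erase _ _ (Finset.mem_univ j)]
  refine Ideal.mul_mem_right _ _ ?_
  obtain ⟨e, he⟩ := Nat.exists_eq_succ_of_ne_zero hj
  rw [he, pow_succ]
  exact Ideal.mul_mem_left _ _ (Ideal.subset_span ⟨j, rfl⟩)

/-- **THE CHART LAW of the weights** [KERNEL]: along a ring map `θ` with `θ(c_l) = θ(c_j)·ε_l` (the `c_j`-chart of the
blowing up of `(c)`), `θ Q_c^{(a,b)}(l) ⊆ θ(c_j)^N · Q_{(ε₀, θ c_j)}^{(a−b, b)}(l − bN)` whenever `b ≤ a`, `0 < a`, `N a ≤ l`: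
a monomial `z^{m₀} u^α` becomes `θ(c_j)^{|m|} ε₀^{m₀} ∏ ε^α`, and after `N` divisions by the exceptional parameter the new
weight `(a − b) m₀ + b(|m| − N)` is the old weight minus `bN`. [folklore] -/
theorem map_qWeighted_le_chart {S : Type} [CommRing S] (θ : R →+* S) {d : ℕ} (c : Fin (d + 1) → R)
    (j : Fin (d + 1)) (ε : Fin (d + 1) → S) (hε : ∀ l, θ (c l) = θ (c j) * ε l) {a b l N : ℕ}
    (hba : b ≤ a) (ha : 0 < a) (hN : N * a ≤ l) :
    (qWeighted c a b l).map θ ≤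
      Ideal.span {θ (c j) ^ N} * qWeighted ![ε 0, θ (c j)] (a - b) b (l - b * N) := by
  change (Ideal.span {x | ∃ m : Fin (d + 1) →₀ ℕ, l ≤ wdeg a b m ∧ x = cMon c m}).map θ ≤ _
  rw [Ideal.map_span, Ideal.span_le]
  rintro _ ⟨_, ⟨m, hm, rfl⟩, rfl⟩
  have hdeg := le_degree_of_le_wdeg hba ha hN m hm
  set D := m 0 + uDeg m with hD
  have himg : θ (cMon c m) = θ (c j) ^ D * Finset.univ.prod fun l => ε l ^ m l := by
    rw [cMon_eq_prod, map_prod]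
    have h1 : (Finset.univ.prod fun l => θ (c l ^ m l)) = Finset.univ.prod fun l => θ (c j) ^ m l * ε l ^ m l :=
      Finset.prod_congr rfl fun l _ => by rw [map_pow, hε, mul_pow]
    rw [h1, Finset.prod_mul_distrib, Finset.prod_pow_eq_pow_sum, degree_eq_add_uDeg]
  have hsplit : (Finset.univ.prod fun l => ε l ^ m l) =
      ε 0 ^ m 0 * Finset.univ.prod fun l : Fin d => ε l.succ ^ m l.succ := Fin.prod_univ_succ _
  rw [SetLike.mem_coe, himg, hsplit, show D = N + (D - N) by omega, pow_add, mul_assoc, ← mul_assoc (θ (c j) ^ (D - N))]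
  refine Ideal.mul_mem_mul (Ideal.mem_span_singleton_self _) (Ideal.mul_mem_right _ _ ?_)
  rw [mul_comm (θ (c j) ^ (D - N)) (ε 0 ^ m 0)]
  refine pow_mul_pow_mem_qWeighted (ε 0) (θ (c j)) ?_
  -- the weight after `N` divisions
  unfold wdeg at hm
  have h1 : b * m 0 ≤ a * m 0 := Nat.mul_le_mul_right _ hba
  have h3 : b * N ≤ b * D := Nat.mul_le_mul_left _ hdeg
  have h4 : b * D = b * m 0 + b * uDeg m := by rw [hD, Nat.mul_add]
  rw [Nat.sub_mul, Nat.mul_sub]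
  omega

/-- **Colon by the exceptional parameter** [KERNEL]: for a non-zero-divisor `t`, an ideal inside `tᴺ · Q` has colon
`(– : tᴺ) ⊆ Q`. [folklore] -/
theorem colon_le_of_le_span_pow_mul {S : Type} [CommRing S] {t : S} (ht : t ∈ nonZeroDivisors S) {N : ℕ}
    {L Q : Ideal S} (hL : L ≤ Ideal.span {t ^ N} * Q) :
    Submodule.colon L ((Ideal.span {t} ^ N : Ideal S) : Set S) ≤ Q := by
  intro r hr
  rw [Submodule.mem_colon] at hr
  have hmem : r * t ^ N ∈ L := by
    have := hr (t ^ N) (by rw [Ideal.span_singleton_pow]; exact Ideal.mem_span_singleton_self _)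
    simpa [smul_eq_mul] using this
  obtain ⟨q, hq, hq'⟩ := Ideal.mem_span_singleton_mul.mp (hL hmem)
  have htN : t ^ N ∈ nonZeroDivisors S := pow_mem ht N
  have : q = r := by
    have h0 : (q - r) * t ^ N = 0 := by rw [sub_mul, mul_comm q, hq', sub_self]
    exact sub_eq_zero.mp ((mul_right_mem_nonZeroDivisors_eq_zero_iff htN).mp h0)
  rw [← this]; exact hq

/-- **Two-variable valuation ideals near the corner**: for `1 ≤ a`, `Q^{(a,n)}(na + 1) ⊆ (z^{n+1}) + (u)`.
[folklore] -/
theorem qWeighted_succ_le_sup (z u : R) (a n : ℕ) :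
    qWeighted ![z, u] a n (n * a + 1) ≤ Ideal.span {z ^ (n + 1)} ⊔ Ideal.span {u} := by
  refine qWeighted_two_le fun i j hij => ?_
  rcases Nat.eq_zero_or_pos j with rfl | hj
  · -- `a i ≥ n a + 1` forces `i ≥ n + 1`
    have hi : n + 1 ≤ i := by
      by_contra h
      push Not at h
      have : a * i ≤ a * n := Nat.mul_le_mul_left _ (by omega)
      nlinarith
    rw [pow_zero, mul_one]
    exact Ideal.mem_sup_left (Ideal.mem_span_singleton.mpr (pow_dvd_pow z hi))
  · refine Ideal.mem_sup_right (Ideal.mem_span_singleton.mpr ?_)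
    exact Dvd.dvd.mul_left (dvd_pow_self u hj.ne') _

/-- **Two-variable valuation ideals at the last stage** (`a = n − 1`): `Q^{(n−1,n)}(n(n−1) + 1) ⊆ u·(z,u)^{n−1} +
(z,u)^{n+1}` — a monomial of weight `> n(n − 1)` has degree `≥ n`, and degree exactly `n` only if `u` divides it.
[folklore] -/
theorem qWeighted_last_le (z u : R) {n a : ℕ} (han : a + 1 = n) (hn : 2 ≤ n) :
    qWeighted ![z, u] a n (n * a + 1) ≤
      Ideal.span {u} * Ideal.span (Set.range ![z, u]) ^ a ⊔ Ideal.span (Set.range ![z, u]) ^ (n + 1) := by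
  have hzP : z ∈ Ideal.span (Set.range ![z, u]) := Ideal.subset_span ⟨0, rfl⟩
  have huP : u ∈ Ideal.span (Set.range ![z, u]) := Ideal.subset_span ⟨1, rfl⟩
  refine qWeighted_two_le fun i j hij => ?_
  obtain ⟨n', rfl⟩ : ∃ n', a = n' + 1 := ⟨a - 1, by omega⟩
  obtain rfl : n = n' + 2 := by omega
  rcases Nat.eq_zero_or_pos j with rfl | hj
  · -- `(n-1) i ≥ n (n - 1) + 1` forces `i ≥ n + 1`
    have hi : n' + 3 ≤ i := by
      by_contra h
      push Not at h
      have : (n' + 1) * i ≤ (n' + 1) * (n' + 2) := Nat.mul_le_mul_left _ (by omega)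
      nlinarith
    rw [pow_zero, mul_one]
    exact Ideal.mem_sup_right (Ideal.pow_le_pow_right hi (Ideal.pow_mem_pow hzP _))
  · -- `j ≥ 1`: the degree is `≥ n`, so `z^i u^(j-1) ∈ (z,u)^(n-1)`
    have hdeg : n' + 1 ≤ i + (j - 1) := by
      by_contra h
      have hij' : i + j ≤ n' + 1 := by omega
      have h1 : (n' + 1) * i + (n' + 2) * j ≤ (n' + 2) * (i + j) := by nlinarith
      have h2 : (n' + 2) * (i + j) ≤ (n' + 2) * (n' + 1) := Nat.mul_le_mul_left _ hij'
      nlinarith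
    obtain ⟨j', rfl⟩ : ∃ j', j = j' + 1 := ⟨j - 1, by omega⟩
    rw [Nat.add_sub_cancel] at hdeg
    have hzu : z ^ i * u ^ j' ∈ Ideal.span (Set.range ![z, u]) ^ (i + j') := by
      rw [pow_add]
      exact Ideal.mul_mem_mul (Ideal.pow_mem_pow hzP _) (Ideal.pow_mem_pow huP _)
    refine Ideal.mem_sup_left ?_
    rw [pow_succ u j', ← mul_assoc, mul_comm (z ^ i * u ^ j') u]
    exact Ideal.mul_mem_mul (Ideal.mem_span_singleton_self u) (Ideal.pow_le_pow_right hdeg hzu)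

end Weighted

end Summit.ResolutionOfSingularities.ResolutionOfSingularities.Theorems.TowerCut
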